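import Summits.CriticalPhenomena.CardyFormulaZ2.Theorems.CardyBoundaryCoulombGasRectilinearCardyStubEventIdentityPart8
import Summits.CriticalPhenomena.CardyFormulaZ2.Theorems.CardyBoundaryCoulombGasRectilinearCardyStubEventIdentityPart9

/-!
# Stub `stub_eventIdentity` of line `excursion-kernel-covariance` (crux `RectilinearCardy`,
# stmt-CriticalPhenomena-5660) — Part 10: the two wired chains as cells and clusters; the CLASS
# LEMMA (layers L5/L6 of the design `Lines/excursion-kernel-covariance-eventIdentity-design.md`)

Setting of Parts 6–9; `β = cfgOf ω`, `ω ⊆ E`; `W₁ = {(e s).1 : iA ≤ s ≤ iB}` and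
`W₂ = {X} ∪ {(e s).1 : iC ≤ s < period}` the two wired vertex blocks; `x ≈ y` the relation "joined
by a path of edges of `ω`" (written inline as a `Relation.ReflTransGen`).

* `ei_arc_of_wired`, `ei_pocket_of_wired`, `ei_free_not_arc` — cycle vertices on wired stretches
  are arc vertices, gap faces before wired states are pockets, vertices of darts free on both
  sides are NOT arc vertices (`tc_spoke_on_wired`: an exterior dart at an arc vertex lies on a
  wired stretch; the cycle has no repeated dart);
* `ei_reach_chain1`, `ei_reach_chain2`, `ei_reach_of_joinedIn` — `A ~β x` for `x ∈ W₁`, `y ~β X`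
  for `y ∈ W₂` (Part 5), and `ω`-paths are `β`-paths;
* `ei_openEdges_not_both_mem` — a frozen open edge never has both endpoints in `V`;
* `ei_class_step`, `ei_class_reachable` — **CLASS LEMMA**: if no vertex of a block `P` is
  `≈`-joined to a vertex of the other block `Q` (blocks told apart by the level `ℓ` of their arc
  vertices), then every cell `β`-reachable from a cell of class `ℓ` — a vertex of `V` `≈`-joined
  to `P`, or a point outside `V` at level `ℓ` — is of class `ℓ` (ω-edges stay in `V`; frozen open
  edges keep the level and meet `V` only at arc vertices).

All [folklore]; no new objects.
-/

namespace Summit.CriticalPhenomena.CardyFormulaZ2.Cruxes.RectilinearCardy.ExcursionKernelCovariance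

open Finset Literature.Probability.LatticeModels Literature.Probability.LatticeModels.CollarLegModel
open Summit.CriticalPhenomena.CardyFormulaZ2.Cruxes.BoundaryDefectGaussianR.RainbowMonomialsInExcursionKernels
open Literature.Probability.Percolation (openGraph openGraph_adj)

/-- **A frozen open edge never has both endpoints in `V`** (it is not live). [folklore] -/
theorem ei_openEdges_not_both_mem (M : CollarLegModel) {e : (ℤ × ℤ) × Bool} (he : e ∈ M.openEdges) :
    ¬(e.1 ∈ M.V ∧ SixVertex.edgeTip e ∈ M.V) := by
  intro h
  rw [openEdges, mem_filter, frozenEdges, mem_sdiff] at he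
  apply he.1.2
  rw [E, inducedEdges, mem_filter]
  exact ⟨(SixVertex.mem_edges_iff _ _).2 (Or.inl h.1), h.1, h.2⟩

/-- **`ω`-paths are `β`-paths**: two points joined by edges of `ω` are joined in
`openGraph (cfgOf ω) ⊓ ℤ²`. [folklore] -/
theorem ei_reach_of_joinedIn (M : CollarLegModel) {ω : Finset ((ℤ × ℤ) × Bool)} {a b : ℤ × ℤ}
    (h : Relation.ReflTransGen (fun b c : ℤ × ℤ ↦ ∃ e ∈ ω,
      (e.1 = b ∧ SixVertex.edgeTip e = c) ∨ (e.1 = c ∧ SixVertex.edgeTip e = b)) a b) :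
    (openGraph (M.cfgOf ω) ⊓ zdGraph 2).Reachable (toSite a) (toSite b) := by
  induction h with
  | refl => exact SimpleGraph.Reachable.refl _
  | tail _ hstep ih =>
    obtain ⟨e, he, hcase⟩ := hstep
    have hadj := ei_adj_of_mem_cfgOf (M := M) (ω := ω) (Or.inl he)
    rcases hcase with ⟨h1, h2⟩ | ⟨h1, h2⟩
    · rw [h1, h2] at hadj; exact ih.trans hadj.reachable
    · rw [h1, h2] at hadj; exact ih.trans hadj.symm.reachable

section Chains

variable {ι : LegInsertionData} {V : Finset (ℤ × ℤ)} {d₀ : Dart} {iA iB iC : ℕ}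
  (hadm : ι.IsAdmissible V)
  (hflat : ∀ x ∈ insert ι.sink ι.source, ∃ dvec : ℤ × ℤ,
      (dvec = (1, 0) ∨ dvec = (-1, 0) ∨ dvec = (0, 1) ∨ dvec = (0, -1)) ∧
      ∀ v : ℤ × ℤ, (v.1 - x.1) ^ 2 + (v.2 - x.2) ^ 2 ≤ ((ι.sinkLegs : ℤ) + 3) ^ 2 →
        (v ∈ V ↔ 0 ≤ (v.1 - x.1) * dvec.1 + (v.2 - x.2) * dvec.2))
  (hchart : ∀ u ∈ V, ∀ k : Fin 4, u + dir k ∉ V → ∃ (K : Fin 4) (c₁ c₂ : ℤ),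
      (∀ v : ℤ × ℤ, |v.1 - u.1| ≤ 3 → |v.2 - u.2| ≤ 3 →
        (v ∈ V ↔ c₂ ≤ v.1 * (dir (K + 1)).1 + v.2 * (dir (K + 1)).2)) ∨
      (∀ v : ℤ × ℤ, |v.1 - u.1| ≤ 3 → |v.2 - u.2| ≤ 3 →
        (v ∈ V ↔ c₁ ≤ v.1 * (dir K).1 + v.2 * (dir K).2 ∧
          c₂ ≤ v.1 * (dir (K + 1)).1 + v.2 * (dir (K + 1)).2)) ∨
      (∀ v : ℤ × ℤ, |v.1 - u.1| ≤ 3 → |v.2 - u.2| ≤ 3 →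
        (v ∈ V ↔ c₂ ≤ v.1 * (dir (K + 1)).1 + v.2 * (dir (K + 1)).2 ∨
          v.1 * (dir K).1 + v.2 * (dir K).2 ≤ c₁)))
  (hv₀ : d₀.1 ∈ V) (ht₀ : dartTip d₀ ∉ V) (hout : outDart V d₀.1 = some d₀)
  (h2 : 2 ≤ iA) (hAB : iA < iB) (hBC : iB < iC) (hCP : iC < period V d₀)
  (hcA : ((neighbours ((dsucc V)^[iA] d₀).1).filter (fun y ↦ y ∉ V)).card = 1)
  (hcB : ((neighbours ((dsucc V)^[iB] d₀).1).filter (fun y ↦ y ∉ V)).card = 1)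
  (hcC : ((neighbours ((dsucc V)^[iC] d₀).1).filter (fun y ↦ y ∉ V)).card = 1)
  (hsrc : ι.source = {((dsucc V)^[iA] d₀).1, ((dsucc V)^[iB] d₀).1, ((dsucc V)^[iC] d₀).1})
  (hlegs : ∀ x ∈ ι.source, ι.legs x = 1) (hsink : ι.sink = d₀.1) (hsl : ι.sinkLegs = 3)

include hout hsink in
/-- A cycle vertex on a wired stretch is an arc vertex. [folklore] -/
theorem ei_arc_of_wired {i : ℕ} (hi : i < period V d₀) (hiV : ((dsucc V)^[i] d₀).1 ∈ V)
    (hw : (List.foldl (fun s d => s.step (ι.startAt V d)) ι.init ((cycle V d₀).take i)).wired = true ∨ (List.foldl (fun s d => s.step (ι.startAt V d)) ι.init ((cycle V d₀).take (i + 1))).wired = true) :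
    ((dsucc V)^[i] d₀).1 ∈ (ι.model V).arcVerts := by
  have h0 : outDart V ι.sink = some d₀ := by rw [hsink]; exact hout
  have hst : ∀ t, (fun t => List.foldl (fun s d => s.step (ι.startAt V d)) ι.init ((cycle V d₀).take t)) t = List.foldl (fun s d => s.step (ι.startAt V d)) ι.init ((cycle V d₀).take t) := fun _ => rfl
  have hlen : (cycle V d₀).length = period V d₀ := by simp [cycle]
  have hget : (cycle V d₀)[i]'(by rw [hlen]; exact hi) = (dsucc V)^[i] d₀ := by simp [cycle]
  refine Finset.mem_inter.2 ⟨?_, hiV⟩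
  exact (mem_collar_arc_iff ι V h0 hst).2 ⟨i, by rw [hlen]; exact hi, hw, by rw [hget]⟩

include hout hsink in
/-- The gap face of a cycle dart followed by a wired state is a pocket. [folklore] -/
theorem ei_pocket_of_wired {i : ℕ} (hi : i < period V d₀) (hiV : ((dsucc V)^[i] d₀).1 ∈ V)
    (hiT : ((dsucc V)^[i] d₀).1 + dir ((dsucc V)^[i] d₀).2 ∉ V)
    (hw : (List.foldl (fun s d => s.step (ι.startAt V d)) ι.init ((cycle V d₀).take (i + 1))).wired = true) :
    gapFace ((dsucc V)^[i] d₀) ∈ (ι.model V).pockets := by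
  have h0 : outDart V ι.sink = some d₀ := by rw [hsink]; exact hout
  have hst : ∀ t, (fun t => List.foldl (fun s d => s.step (ι.startAt V d)) ι.init ((cycle V d₀).take t)) t = List.foldl (fun s d => s.step (ι.startAt V d)) ι.init ((cycle V d₀).take t) := fun _ => rfl
  have hlen : (cycle V d₀).length = period V d₀ := by simp [cycle]
  have hget : (cycle V d₀)[i]'(by rw [hlen]; exact hi) = (dsucc V)^[i] d₀ := by simp [cycle]
  refine Finset.mem_inter.2 ⟨?_, tc_gapFace_mem_bdryFaces hiV hiT⟩
  exact (mem_collar_pocket_iff ι V h0 hst).2 ⟨i, by rw [hlen]; exact hi, hw, by rw [hget]⟩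

include hadm hflat hchart hv₀ ht₀ hout hsink in
/-- **The vertex of a dart free on both sides is not an arc vertex** (an exterior dart at an arc
vertex lies on a wired stretch, `tc_spoke_on_wired`; the cycle has no repeated dart). [folklore] -/
theorem ei_free_not_arc {i : ℕ} (hi : i < period V d₀)
    (hw0 : (List.foldl (fun s d => s.step (ι.startAt V d)) ι.init ((cycle V d₀).take i)).wired = false)
    (hw1 : (List.foldl (fun s d => s.step (ι.startAt V d)) ι.init ((cycle V d₀).take (i + 1))).wired = false) :
    ((dsucc V)^[i] d₀).1 ∉ (ι.model V).arcVerts := by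
  intro harc
  have h0 : outDart V ι.sink = some d₀ := by rw [hsink]; exact hout
  have hst : ∀ t, (fun t => List.foldl (fun s d => s.step (ι.startAt V d)) ι.init ((cycle V d₀).take t)) t = List.foldl (fun s d => s.step (ι.startAt V d)) ι.init ((cycle V d₀).take t) := fun _ => rfl
  have hlen : (cycle V d₀).length = period V d₀ := by simp [cycle]
  have hext : ((dsucc V)^[i] d₀).1 ∈ V ∧ dartTip ((dsucc V)^[i] d₀) ∉ V :=
    (s3_dsucc_iterate V i).1 d₀ hv₀ ht₀
  obtain ⟨t₂, ht₂, hds, hw⟩ := tc_spoke_on_wired ι V hadm h0 hst hflat hchart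
    (Finset.mem_inter.1 harc).1 (k' := ((dsucc V)^[i] d₀).2) hext.2
  have hget : (cycle V d₀)[t₂] = (dsucc V)^[t₂] d₀ := by simp [cycle]
  rw [hget] at hds
  have hti : t₂ = i := sm_iter_inj hv₀ ht₀ (by rw [← hlen]; exact ht₂) hi (by rw [hds])
  subst hti
  rcases hw with hw | hw
  · rw [hw0] at hw; exact Bool.false_ne_true hw
  · rw [hw1] at hw; exact Bool.false_ne_true hw

include hv₀ ht₀ hout h2 hAB hBC hCP hcA hcB hcC hsrc hlegs hsink hsl in
/-- **The level `-1` chain is one `β`-cluster**: `A ~β x` for every vertex `x = (e s).1`,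
`iA ≤ s ≤ iB`, whatever `ω`. [folklore] -/
theorem ei_reach_chain1 (ω : Finset ((ℤ × ℤ) × Bool)) {s : ℕ} (hs : iA ≤ s) (hs' : s ≤ iB) :
    (openGraph ((ι.model V).cfgOf ω) ⊓ zdGraph 2).Reachable (toSite ((dsucc V)^[iA] d₀).1)
      (toSite ((dsucc V)^[s] d₀).1) := by
  obtain ⟨S, hS⟩ : ∃ S : ℕ → WalkState, ∀ t, S t = if t = 0 then ⟨-3, true, 0, 0⟩
      else if t = 1 then ⟨-2, false, 2, 1⟩ else if t ≤ iA then ⟨0, false, 0, 1⟩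
      else if t ≤ iB then ⟨-1, true, 0, -1⟩ else if t ≤ iC then ⟨-2, false, 0, -1⟩
      else ⟨-3, true, 0, -1⟩ := ⟨_, fun t => rfl⟩
  have hW := ei_walk_state hv₀ ht₀ hout h2 hAB hBC hCP hcA hcB hcC hsrc hlegs hsink hsl hS
  have hext : ∀ i, ((dsucc V)^[i] d₀).1 ∈ V ∧ dartTip ((dsucc V)^[i] d₀) ∉ V :=
    fun i => (s3_dsucc_iterate V i).1 d₀ hv₀ ht₀
  have hwired : ∀ i, iA ≤ i → i < iB → (List.foldl (fun s d => s.step (ι.startAt V d)) ι.init ((cycle V d₀).take (i + 1))).wired = true := by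
    intro i h1 h3
    rw [hW (i + 1) (by omega), hS, if_neg (by omega), if_neg (by omega), if_neg (by omega), if_pos (by omega)]
  refine ei_reachable_of_wired_stretch (M := (ι.model V)) hv₀ ht₀ hs (fun i h1 h3 => ?_) (fun i h1 h3 => ?_)
  · refine ei_arc_of_wired hout hsink (by omega) (hext i).1 ?_
    rcases Nat.lt_or_ge i iB with h | h
    · exact Or.inr (hwired i h1 h)
    · left
      have hi : i = iB := by omega
      subst hi
      have := hwired (i - 1) (by omega) (by omega)
      rwa [show i - 1 + 1 = i by omega] at this
  · exact ei_pocket_of_wired hout hsink (by omega) (hext i).1 (hext i).2 (hwired i h1 (by omega))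

include hv₀ ht₀ hout h2 hAB hBC hCP hcA hcB hcC hsrc hlegs hsink hsl in
/-- **The level `-3` chain is one `β`-cluster**: `y ~β X` for every vertex `y = (e s).1`,
`iC ≤ s ≤ period` (the cycle closes up at `e period = d₀`). [folklore] -/
theorem ei_reach_chain2 (ω : Finset ((ℤ × ℤ) × Bool)) {s : ℕ} (hs : iC ≤ s) (hs' : s ≤ period V d₀) :
    (openGraph ((ι.model V).cfgOf ω) ⊓ zdGraph 2).Reachable (toSite ((dsucc V)^[s] d₀).1) (toSite d₀.1) := by
  obtain ⟨S, hS⟩ : ∃ S : ℕ → WalkState, ∀ t, S t = if t = 0 then ⟨-3, true, 0, 0⟩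
      else if t = 1 then ⟨-2, false, 2, 1⟩ else if t ≤ iA then ⟨0, false, 0, 1⟩
      else if t ≤ iB then ⟨-1, true, 0, -1⟩ else if t ≤ iC then ⟨-2, false, 0, -1⟩
      else ⟨-3, true, 0, -1⟩ := ⟨_, fun t => rfl⟩
  have hW := ei_walk_state hv₀ ht₀ hout h2 hAB hBC hCP hcA hcB hcC hsrc hlegs hsink hsl hS
  have hext : ∀ i, ((dsucc V)^[i] d₀).1 ∈ V ∧ dartTip ((dsucc V)^[i] d₀) ∉ V :=
    fun i => (s3_dsucc_iterate V i).1 d₀ hv₀ ht₀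
  have hP : (dsucc V)^[period V d₀] d₀ = d₀ := (s3_period_spec V d₀ hv₀ ht₀).2.2.1
  have hwired : ∀ i, iC ≤ i → i < period V d₀ → (List.foldl (fun s d => s.step (ι.startAt V d)) ι.init ((cycle V d₀).take (i + 1))).wired = true := by
    intro i h1 h3
    rw [hW (i + 1) (by omega), hS, if_neg (by omega), if_neg (by omega), if_neg (by omega), if_neg (by omega),
      if_neg (by omega)]
  have hP' : (dsucc (ι.model V).V)^[period V d₀] d₀ = d₀ := hP
  have h0w : (List.foldl (fun s d => s.step (ι.startAt V d)) ι.init ((cycle V d₀).take 0)).wired = true := by rw [hW 0 (by omega), hS, if_pos rfl]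
  have hreach := ei_reachable_of_wired_stretch (M := (ι.model V)) (ω := ω) hv₀ ht₀ hs'
    (fun i h1 h3 => ?_) (fun i h1 h3 => ?_)
  · rw [hP'] at hreach; exact hreach
  · rcases Nat.lt_or_ge i (period V d₀) with h | h
    · exact ei_arc_of_wired hout hsink h (hext i).1 (Or.inr (hwired i (by omega) h))
    · have hi : i = period V d₀ := by omega
      rw [hi, hP']
      exact ei_arc_of_wired (ι := ι) hout hsink (i := 0) (by omega) hv₀ (Or.inl h0w)
  · exact ei_pocket_of_wired hout hsink h3 (hext i).1 (hext i).2 (hwired i (by omega) h3)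

include hadm hflat hchart in
/-- **CLASS LEMMA, one step.** Let `ℓ` be a level and `P`, `Q` two predicates on points such that
every arc vertex carries level `ℓ` and satisfies `P`, or another level and satisfies `Q`, and no
point of `P` is `ω`-joined to a point of `Q`. Call a site of CLASS `ℓ` a vertex of `V` that is
`ω`-joined to a point of `P`, or a point outside `V` at level `ℓ`. Then the class is preserved along
every edge of `openGraph (cfgOf ω)`. [folklore] -/
theorem ei_class_step {ω : Finset ((ℤ × ℤ) × Bool)} (hω : ω ⊆ (ι.model V).E) (ℓ : ℤ) (P Q : ℤ × ℤ → Prop)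
    (hPQ : ∀ a ∈ (ι.model V).arcVerts, ((ι.collar V).vertH a = ℓ ∧ P a) ∨ ((ι.collar V).vertH a ≠ ℓ ∧ Q a))
    (hsep : ∀ w a, P w → Q a → ¬Relation.ReflTransGen (fun b c : ℤ × ℤ ↦ ∃ e ∈ ω,
      (e.1 = b ∧ SixVertex.edgeTip e = c) ∨ (e.1 = c ∧ SixVertex.edgeTip e = b)) w a)
    {x x' : Site 2} (hadj : (openGraph ((ι.model V).cfgOf ω)).Adj x x')
    (hx : (ofSite x ∈ V ∧ ∃ w, P w ∧ Relation.ReflTransGen (fun b c : ℤ × ℤ ↦ ∃ e ∈ ω,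
        (e.1 = b ∧ SixVertex.edgeTip e = c) ∨ (e.1 = c ∧ SixVertex.edgeTip e = b)) w (ofSite x)) ∨
      (ofSite x ∉ V ∧ (ι.collar V).vertH (ofSite x) = ℓ)) :
    (ofSite x' ∈ V ∧ ∃ w, P w ∧ Relation.ReflTransGen (fun b c : ℤ × ℤ ↦ ∃ e ∈ ω,
        (e.1 = b ∧ SixVertex.edgeTip e = c) ∨ (e.1 = c ∧ SixVertex.edgeTip e = b)) w (ofSite x')) ∨
      (ofSite x' ∉ V ∧ (ι.collar V).vertH (ofSite x') = ℓ) := by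
  rw [openGraph_adj] at hadj
  obtain ⟨hmem, -⟩ := hadj
  rw [cfgOf, Finset.mem_coe, Finset.mem_image] at hmem
  obtain ⟨e, he', hexx⟩ := hmem
  have he : e ∈ ω ∨ e ∈ (ι.model V).openEdges := Finset.mem_union.1 he'
  -- orient the edge: `a = ofSite x`, `b = ofSite x'`
  have hor : (e.1 = ofSite x ∧ SixVertex.edgeTip e = ofSite x') ∨
      (e.1 = ofSite x' ∧ SixVertex.edgeTip e = ofSite x) := by
    rw [edgeSym2, Sym2.eq_iff] at hexx
    rcases hexx with ⟨h1, h2⟩ | ⟨h1, h2⟩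
    · exact Or.inl ⟨by rw [← h1, ofSite_toSite], by rw [← h2, ofSite_toSite]⟩
    · exact Or.inr ⟨by rw [← h1, ofSite_toSite], by rw [← h2, ofSite_toSite]⟩
  have harcV : (ι.model V).arcVerts ⊆ V := Finset.inter_subset_right
  rcases he with he | he
  · -- a live open edge: both endpoints in `V`, the `ω`-path extends
    have hE := hω he
    rw [E, inducedEdges, mem_filter] at hE
    have haV : ofSite x ∈ V := by
      rcases hor with ⟨h1, -⟩ | ⟨-, h2⟩
      · exact h1 ▸ hE.2.1
      · exact h2 ▸ hE.2.2
    have hbV : ofSite x' ∈ V := by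
      rcases hor with ⟨-, h2⟩ | ⟨h1, -⟩
      · exact h2 ▸ hE.2.2
      · exact h1 ▸ hE.2.1
    rcases hx with ⟨-, w, hw, hJ⟩ | ⟨hxV, -⟩
    · exact Or.inl ⟨hbV, w, hw, hJ.tail ⟨e, he, hor⟩⟩
    · exact absurd haV hxV
  · -- a frozen open edge: the level is kept, at most one endpoint in `V`, which is an arc vertex
    have hlev : (ι.collar V).vertH (ofSite x) = (ι.collar V).vertH (ofSite x') := by
      have h := openEdges_vertH_eq ι V hadm hflat hchart he
      rcases hor with ⟨h1, h2⟩ | ⟨h1, h2⟩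
      · rw [h1, h2] at h; exact h
      · rw [h1, h2] at h; exact h.symm
    have hnot := ei_openEdges_not_both_mem (ι.model V) he
    have harc_end : ofSite x ∈ V ∨ ofSite x' ∈ V → ofSite x ∈ (ι.model V).arcVerts ∨ ofSite x' ∈ (ι.model V).arcVerts := by
      intro hV
      have hV' : e.1 ∈ (ι.model V).V ∨ SixVertex.edgeTip e ∈ (ι.model V).V := by
        rcases hor with ⟨h1, h2⟩ | ⟨h1, h2⟩
        · rcases hV with h | h
          · exact Or.inl (h1 ▸ h)
          · exact Or.inr (h2 ▸ h)
        · rcases hV with h | h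
          · exact Or.inr (h2 ▸ h)
          · exact Or.inl (h1 ▸ h)
      rcases se_openEdges_arc (ι.model V) he hV' with h | h
      · rcases hor with ⟨h1, -⟩ | ⟨h1, -⟩
        · exact Or.inl (h1 ▸ h)
        · exact Or.inr (h1 ▸ h)
      · rcases hor with ⟨-, h2⟩ | ⟨-, h2⟩
        · exact Or.inr (h2 ▸ h)
        · exact Or.inl (h2 ▸ h)
    have hboth : ¬(ofSite x ∈ V ∧ ofSite x' ∈ V) := by
      rintro ⟨h1, h2⟩
      apply hnot
      rcases hor with ⟨ha, hb⟩ | ⟨ha, hb⟩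
      · exact ⟨ha ▸ h1, hb ▸ h2⟩
      · exact ⟨ha ▸ h2, hb ▸ h1⟩
    rcases hx with ⟨haV, w, hw, hJ⟩ | ⟨haV, hl⟩
    · -- `a ∈ V`: then `b ∉ V` and `a` is an arc vertex, of level `ℓ` (else `Q a`, joined to `P w`)
      have hbV : ofSite x' ∉ V := fun h => hboth ⟨haV, h⟩
      have haA : ofSite x ∈ (ι.model V).arcVerts := by
        rcases harc_end (Or.inl haV) with h | h
        · exact h
        · exact absurd (harcV h) hbV
      rcases hPQ _ haA with ⟨hl, -⟩ | ⟨-, hQ⟩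
      · exact Or.inr ⟨hbV, hlev ▸ hl⟩
      · exact absurd hJ (hsep w _ hw hQ)
    · -- `a ∉ V` at level `ℓ`: `b` is at level `ℓ`; if in `V` it is an arc vertex with `P b`
      by_cases hbV : ofSite x' ∈ V
      · have hbA : ofSite x' ∈ (ι.model V).arcVerts := by
          rcases harc_end (Or.inr hbV) with h | h
          · exact absurd (harcV h) haV
          · exact h
        rcases hPQ _ hbA with ⟨-, hP⟩ | ⟨hl', -⟩
        · exact Or.inl ⟨hbV, ofSite x', hP, Relation.ReflTransGen.refl⟩
        · exact absurd (hlev ▸ hl) hl'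
      · exact Or.inr ⟨hbV, hlev ▸ hl⟩

include hadm hflat hchart in
/-- **CLASS LEMMA.** Under the hypotheses of `ei_class_step`, every site reachable in
`openGraph (cfgOf ω)` from a site of class `ℓ` is of class `ℓ`. [folklore] -/
theorem ei_class_reachable {ω : Finset ((ℤ × ℤ) × Bool)} (hω : ω ⊆ (ι.model V).E) (ℓ : ℤ) (P Q : ℤ × ℤ → Prop)
    (hPQ : ∀ a ∈ (ι.model V).arcVerts, ((ι.collar V).vertH a = ℓ ∧ P a) ∨ ((ι.collar V).vertH a ≠ ℓ ∧ Q a))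
    (hsep : ∀ w a, P w → Q a → ¬Relation.ReflTransGen (fun b c : ℤ × ℤ ↦ ∃ e ∈ ω,
      (e.1 = b ∧ SixVertex.edgeTip e = c) ∨ (e.1 = c ∧ SixVertex.edgeTip e = b)) w a)
    {x x' : Site 2} (hreach : (openGraph ((ι.model V).cfgOf ω)).Reachable x x')
    (hx : (ofSite x ∈ V ∧ ∃ w, P w ∧ Relation.ReflTransGen (fun b c : ℤ × ℤ ↦ ∃ e ∈ ω,
        (e.1 = b ∧ SixVertex.edgeTip e = c) ∨ (e.1 = c ∧ SixVertex.edgeTip e = b)) w (ofSite x)) ∨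
      (ofSite x ∉ V ∧ (ι.collar V).vertH (ofSite x) = ℓ)) :
    (ofSite x' ∈ V ∧ ∃ w, P w ∧ Relation.ReflTransGen (fun b c : ℤ × ℤ ↦ ∃ e ∈ ω,
        (e.1 = b ∧ SixVertex.edgeTip e = c) ∨ (e.1 = c ∧ SixVertex.edgeTip e = b)) w (ofSite x')) ∨
      (ofSite x' ∉ V ∧ (ι.collar V).vertH (ofSite x') = ℓ) := by
  rw [SimpleGraph.reachable_iff_reflTransGen] at hreach
  induction hreach with
  | refl => exact hx
  | tail _ hadj ih => exact ei_class_step hadm hflat hchart hω ℓ P Q hPQ hsep hadj ih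

end Chains

/-- **Registered form of `ei_free_not_arc`** (landing anchor, all hypotheses explicit). [folklore] -/
theorem ei_free_not_arc_explicit {ι : LegInsertionData} {V : Finset (ℤ × ℤ)} {d₀ : Dart}
    (hadm : ι.IsAdmissible V)
    (hflat : ∀ x ∈ insert ι.sink ι.source, ∃ dvec : ℤ × ℤ,
      (dvec = (1, 0) ∨ dvec = (-1, 0) ∨ dvec = (0, 1) ∨ dvec = (0, -1)) ∧
      ∀ v : ℤ × ℤ, (v.1 - x.1) ^ 2 + (v.2 - x.2) ^ 2 ≤ ((ι.sinkLegs : ℤ) + 3) ^ 2 →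
        (v ∈ V ↔ 0 ≤ (v.1 - x.1) * dvec.1 + (v.2 - x.2) * dvec.2))
    (hchart : ∀ u ∈ V, ∀ k : Fin 4, u + dir k ∉ V → ∃ (K : Fin 4) (c₁ c₂ : ℤ),
      (∀ v : ℤ × ℤ, |v.1 - u.1| ≤ 3 → |v.2 - u.2| ≤ 3 →
        (v ∈ V ↔ c₂ ≤ v.1 * (dir (K + 1)).1 + v.2 * (dir (K + 1)).2)) ∨
      (∀ v : ℤ × ℤ, |v.1 - u.1| ≤ 3 → |v.2 - u.2| ≤ 3 →
        (v ∈ V ↔ c₁ ≤ v.1 * (dir K).1 + v.2 * (dir K).2 ∧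
          c₂ ≤ v.1 * (dir (K + 1)).1 + v.2 * (dir (K + 1)).2)) ∨
      (∀ v : ℤ × ℤ, |v.1 - u.1| ≤ 3 → |v.2 - u.2| ≤ 3 →
        (v ∈ V ↔ c₂ ≤ v.1 * (dir (K + 1)).1 + v.2 * (dir (K + 1)).2 ∨
          v.1 * (dir K).1 + v.2 * (dir K).2 ≤ c₁)))
    (hv₀ : d₀.1 ∈ V) (ht₀ : dartTip d₀ ∉ V) (hout : outDart V d₀.1 = some d₀) (hsink : ι.sink = d₀.1)
    {i : ℕ} (hi : i < period V d₀)
    (hw0 : (List.foldl (fun s d => s.step (ι.startAt V d)) ι.init ((cycle V d₀).take i)).wired = false)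
    (hw1 : (List.foldl (fun s d => s.step (ι.startAt V d)) ι.init ((cycle V d₀).take (i + 1))).wired = false) :
    ((dsucc V)^[i] d₀).1 ∉ (ι.model V).arcVerts :=
  ei_free_not_arc hadm hflat hchart hv₀ ht₀ hout hsink hi hw0 hw1

end Summit.CriticalPhenomena.CardyFormulaZ2.Cruxes.RectilinearCardy.ExcursionKernelCovariance
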